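import Literature.Geometry.Manifold.AmbientForm
import Literature.Geometry.Symplectic.PlaneRotationOfTwoForm
import Literature.Geometry.Kaehler.FubiniStudy
import HarnessLib

/-!
# Normal data of a symplectic surface in a symplectic `4`-manifold, read in a Whitney embedding

Topic `Literature/Geometry/Symplectic`; second layer (C1b-ii) of the construction of the
symplectic tubular neighbourhood of a symplectic surface with its `U(1)`-structure (McLean,
*The growth rate of symplectic homology and affine varieties*, GAFA 2012, **Lemma 5.14**, `k = 1`:
"there is a neighbourhood `US` of `S` and a projection `π : US → S` … a `U(1)`-bundle whose
fibres are symplectic discs"; McDuff–Salamon 2017, Thm. 3.4.10 / Ex. 4.4.5), for the fact seat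
of `Literature.Geometry.Symplectic.mclean_divisorComplement_convex_four`.

Following the tree's bundle-free treatment of tubular neighbourhoods
(`Literature/Topology/FourManifolds/NormalRetraction.lean`) everything is read in a Whitney
embedding `e : N → V` of the ambient `4`-manifold: a `Setup` packages a closed non-degenerate
smooth `2`-form `s` on `N`, the embedding `e`, and a symplectic embedded surface `b : S → N`.
Along the surface we then have, as SMOOTH fields on `S` of linear-algebra data on the fixed
inner product space `V`:

* `Setup.f = e ∘ b`, the tangent planes `TN y = de(T_{b y} N)`, `TS y = df(T_y S) ≤ TN y`, and
  the **Euclidean normal plane** `F y = (TS y)ᗮ ⊓ TN y` of the surface inside the ambient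
  tangent space (`finrank_F : dim F = 2`), with its orthogonal projection
  `Q y = P^N_{b y} - P^S_y` (`Q_eq`, `contMDiff_Q`);
* the ambient symplectic form `Sf y = s.ambient e (b y)` (`contMDiff_Sf`), non-degenerate on
  `TN y` and on `TS y` (`Sf_tvec_ne_zero`);
* the **symplectic projection** `symProj y : V →L V` onto `TS y` along its `Sf`-annihilator
  (`symProj_apply_mem`, `Sf_sub_symProj_apply`, uniqueness `eq_symProj_apply`,
  `contMDiff_symProj`), and the `2`-form `o y = Sf y ∘ Λ²(1 - symProj y)` (`contMDiff_o`,
  block decomposition `Sf_apply_eq_add_o : Sf(v, w) = Sf(Pˢv, Pˢw) + o(v, w)`), which on the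
  normal plane is the symplectic form of the symplectic normal bundle `TS^ω` transported to
  `F y` — it never vanishes there (`exists_o_ne_zero`);
* whence, by `PlaneRotationOfTwoForm.lean`, the **rotation by a right angle** `J y` of the
  normal plane, the compressed operator `Om y = K y • J y` and the area factor `K y > 0`
  (`contMDiff_J`, `contMDiff_K`, `o_apply_Q_eq : o(Qv, Qw) = K ⟪J v, w⟫`,
  `o_Q_J : o(Q v, J v) = K ‖Q v‖²`, `J_J_apply : J² = -Q`), i.e. the `U(1)`-rotations of the
  normal planes used to build the tube and its model Liouville form `½ K ⟪J n, dn⟫`.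

Everything here is proved; no named facts (D-0026).

## References

* M. McLean, *The growth rate of symplectic homology and affine varieties*, GAFA 22 (2012),
  Lemma 5.14 and the proof of Lemma 5.17, pp. 35–37 (arXiv:1011.2542). [Mclean2012]
* D. McDuff, D. Salamon, *Introduction to Symplectic Topology*, 3rd ed. (2017), Thm. 3.4.10,
  Ex. 4.4.5. [McDuffSalamon2017]
* M. W. Hirsch, *Differential Topology* (1976), Ch. 4 §5. [HirschDT1976]
-/

noncomputable section

open scoped Manifold ContDiff Topology RealInnerProductSpace
open Set Function Module
open Literature.Topology.FourManifolds
open Literature.Geometry.Kaehler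
open Literature.Geometry.Manifold

namespace Literature.Geometry.Symplectic

/-! ### The symplectic projection onto a symplectic `2`-plane (linear algebra) -/

section SymProj

variable {V : Type*} [NormedAddCommGroup V] [InnerProductSpace ℝ V]

/-- Subtractivity of a `2`-form in its first argument. [folklore] -/
theorem twoForm_sub_left (B : V [⋀^Fin 2]→L[ℝ] ℝ) (u v w : V) :
    B ![u - v, w] = B ![u, w] - B ![v, w] := by
  rw [sub_eq_add_neg, cam₂_add_left, ← neg_one_smul ℝ v, cam₂_smul_left, neg_one_smul,
    ← sub_eq_add_neg]

/-- A `2`-form vanishes when its first argument vanishes. [folklore] -/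
theorem twoForm_zero_left (B : V [⋀^Fin 2]→L[ℝ] ℝ) (w : V) : B ![(0 : V), w] = 0 := by
  have h := cam₂_smul_left B 0 w w
  rwa [zero_smul, zero_smul] at h

/-- **The `B`-symplectic projection onto the plane spanned by `t₀, t₁`** (for a `2`-form `B` with
`B(t₀, t₁) ≠ 0`): `P v = B(t₀, t₁)⁻¹ (B(v, t₁) t₀ - B(v, t₀) t₁)`, the projection onto
`span {t₀, t₁}` along its `B`-annihilator (McDuff–Salamon 2017, Lemma 2.1.1 / §2.1: a symplectic
subspace has a symplectic complement, `V = W ⊕ W^ω`). [cite: McDuffSalamon2017, Lemma 2.1.1] -/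
def symProjOf (B : V [⋀^Fin 2]→L[ℝ] ℝ) (t₀ t₁ : V) : V →L[ℝ] V :=
  (B ![t₀, t₁])⁻¹ • (((alt2Flat B t₀).smulRight t₁) - ((alt2Flat B t₁).smulRight t₀))

/-- Unfolding of `symProjOf`. [folklore] -/
theorem symProjOf_apply (B : V [⋀^Fin 2]→L[ℝ] ℝ) (t₀ t₁ v : V) :
    symProjOf B t₀ t₁ v = (B ![t₀, t₁])⁻¹ • (B ![v, t₁] • t₀ - B ![v, t₀] • t₁) := by
  rw [symProjOf]
  show (B ![t₀, t₁])⁻¹ • ((alt2Flat B t₀ v) • t₁ - (alt2Flat B t₁ v) • t₀) = _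
  rw [alt2Flat_apply, alt2Flat_apply, cam₂_swap B t₀ v, cam₂_swap B t₁ v, neg_smul, neg_smul,
    sub_neg_eq_add, neg_add_eq_sub]

/-- `P v ∈ span {t₀, t₁}`. [folklore] -/
theorem symProjOf_apply_mem (B : V [⋀^Fin 2]→L[ℝ] ℝ) (t₀ t₁ v : V) :
    symProjOf B t₀ t₁ v ∈ Submodule.span ℝ {t₀, t₁} := by
  rw [symProjOf_apply]
  refine Submodule.smul_mem _ _ (Submodule.sub_mem _ (Submodule.smul_mem _ _ ?_)
    (Submodule.smul_mem _ _ ?_))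
  · exact Submodule.subset_span (by simp)
  · exact Submodule.subset_span (by simp)

/-- **`v - P v` is `B`-orthogonal to `t₀`.** [folklore] -/
theorem twoForm_sub_symProjOf_left (B : V [⋀^Fin 2]→L[ℝ] ℝ) {t₀ t₁ : V} (hB : B ![t₀, t₁] ≠ 0)
    (v : V) : B ![v - symProjOf B t₀ t₁ v, t₀] = 0 := by
  rw [symProjOf_apply, twoForm_sub_left, cam₂_smul_left, twoForm_sub_left, cam₂_smul_left, cam₂_smul_left,
    twoForm_self, cam₂_swap B t₁ t₀]
  simp only [smul_eq_mul]
  field_simp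
  ring

/-- **`v - P v` is `B`-orthogonal to `t₁`.** [folklore] -/
theorem twoForm_sub_symProjOf_right (B : V [⋀^Fin 2]→L[ℝ] ℝ) {t₀ t₁ : V} (hB : B ![t₀, t₁] ≠ 0)
    (v : V) : B ![v - symProjOf B t₀ t₁ v, t₁] = 0 := by
  rw [symProjOf_apply, twoForm_sub_left, cam₂_smul_left, twoForm_sub_left, cam₂_smul_left, cam₂_smul_left,
    twoForm_self]
  simp only [smul_eq_mul]
  field_simp
  ring

/-- Elements of `span {t₀, t₁}` are the combinations `a t₀ + c t₁`. [folklore] -/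
theorem mem_span_pair_iff {t₀ t₁ w : V} :
    w ∈ Submodule.span ℝ {t₀, t₁} ↔ ∃ a c : ℝ, w = a • t₀ + c • t₁ := by
  rw [Submodule.mem_span_pair]
  constructor
  · rintro ⟨a, c, rfl⟩; exact ⟨a, c, rfl⟩
  · rintro ⟨a, c, rfl⟩; exact ⟨a, c, rfl⟩

/-- `v - P v` is `B`-orthogonal to the whole plane. [folklore] -/
theorem twoForm_sub_symProjOf_of_mem (B : V [⋀^Fin 2]→L[ℝ] ℝ) {t₀ t₁ : V}
    (hB : B ![t₀, t₁] ≠ 0) (v : V) {t : V} (ht : t ∈ Submodule.span ℝ {t₀, t₁}) :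
    B ![v - symProjOf B t₀ t₁ v, t] = 0 := by
  obtain ⟨a, c, rfl⟩ := mem_span_pair_iff.1 ht
  rw [cam₂_add_right, cam₂_smul_right, cam₂_smul_right, twoForm_sub_symProjOf_left B hB,
    twoForm_sub_symProjOf_right B hB, smul_zero, smul_zero, add_zero]

/-- **Uniqueness of the symplectic projection**: an element `p` of the plane with `v - p`
`B`-orthogonal to `t₀` and `t₁` is `P v`. [folklore] -/
theorem eq_symProjOf_apply (B : V [⋀^Fin 2]→L[ℝ] ℝ) {t₀ t₁ : V} (hB : B ![t₀, t₁] ≠ 0)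
    {v p : V} (hp : p ∈ Submodule.span ℝ {t₀, t₁}) (h₀ : B ![v - p, t₀] = 0)
    (h₁ : B ![v - p, t₁] = 0) : p = symProjOf B t₀ t₁ v := by
  obtain ⟨a, c, rfl⟩ := mem_span_pair_iff.1 hp
  rw [twoForm_sub_left, cam₂_add_left, cam₂_smul_left, cam₂_smul_left, twoForm_self,
    cam₂_swap B t₁ t₀] at h₀
  rw [twoForm_sub_left, cam₂_add_left, cam₂_smul_left, cam₂_smul_left, twoForm_self] at h₁
  simp only [smul_eq_mul, mul_zero, zero_add, add_zero, mul_neg] at h₀ h₁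
  have ha : a = (B ![t₀, t₁])⁻¹ * B ![v, t₁] := by
    field_simp; linarith
  have hc : c = -((B ![t₀, t₁])⁻¹ * B ![v, t₀]) := by
    field_simp; linarith
  rw [symProjOf_apply, ha, hc, smul_sub, smul_smul, smul_smul, neg_smul, sub_eq_add_neg]

/-- **Frame independence**: the symplectic projections of two pairs spanning the same plane agree.
[folklore] -/
theorem symProjOf_eq_of_mem_span (B : V [⋀^Fin 2]→L[ℝ] ℝ) {t₀ t₁ t₀' t₁' : V}
    (hB : B ![t₀, t₁] ≠ 0) (hB' : B ![t₀', t₁'] ≠ 0)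
    (h₀ : t₀' ∈ Submodule.span ℝ {t₀, t₁}) (h₁ : t₁' ∈ Submodule.span ℝ {t₀, t₁})
    (h₀' : t₀ ∈ Submodule.span ℝ {t₀', t₁'}) (h₁' : t₁ ∈ Submodule.span ℝ {t₀', t₁'}) (v : V) :
    symProjOf B t₀' t₁' v = symProjOf B t₀ t₁ v := by
  refine eq_symProjOf_apply B hB ?_ ?_ ?_
  · have hle : Submodule.span ℝ {t₀', t₁'} ≤ Submodule.span ℝ {t₀, t₁} :=
      Submodule.span_le.2 (by
        rintro x hx
        simp only [Set.mem_insert_iff, Set.mem_singleton_iff] at hx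
        rcases hx with rfl | rfl
        exacts [h₀, h₁])
    exact hle (symProjOf_apply_mem B t₀' t₁' v)
  · exact twoForm_sub_symProjOf_of_mem B hB' v h₀'
  · exact twoForm_sub_symProjOf_of_mem B hB' v h₁'

/-- `P` is the identity on the plane. [folklore] -/
theorem symProjOf_apply_of_mem (B : V [⋀^Fin 2]→L[ℝ] ℝ) {t₀ t₁ : V} (hB : B ![t₀, t₁] ≠ 0)
    {t : V} (ht : t ∈ Submodule.span ℝ {t₀, t₁}) : symProjOf B t₀ t₁ t = t :=
  (eq_symProjOf_apply B hB ht (by rw [sub_self, twoForm_zero_left])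
    (by rw [sub_self, twoForm_zero_left])).symm

/-- Value of a `2`-form on two combinations of a pair. [folklore] -/
theorem twoForm_pair_eq (B : V [⋀^Fin 2]→L[ℝ] ℝ) (a c a' c' : ℝ) (t₀ t₁ : V) :
    B ![a • t₀ + c • t₁, a' • t₀ + c' • t₁] = (a * c' - c * a') * B ![t₀, t₁] := by
  rw [cam₂_add_left, cam₂_smul_left, cam₂_smul_left, cam₂_add_right, cam₂_smul_right,
    cam₂_smul_right, cam₂_add_right, cam₂_smul_right, cam₂_smul_right, twoForm_self,
    twoForm_self, cam₂_swap B t₁ t₀]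
  simp only [smul_eq_mul]
  ring

/-- A `2`-form nonzero on a pair is nonzero on any pair spanning it. [folklore] -/
theorem twoForm_ne_zero_of_mem_span (B : V [⋀^Fin 2]→L[ℝ] ℝ) {t₀ t₁ t₀' t₁' : V}
    (hB : B ![t₀, t₁] ≠ 0) (h₀ : t₀ ∈ Submodule.span ℝ {t₀', t₁'})
    (h₁ : t₁ ∈ Submodule.span ℝ {t₀', t₁'}) : B ![t₀', t₁'] ≠ 0 := by
  obtain ⟨a, c, rfl⟩ := mem_span_pair_iff.1 h₀
  obtain ⟨a', c', rfl⟩ := mem_span_pair_iff.1 h₁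
  rw [twoForm_pair_eq] at hB
  exact fun h ↦ hB (by rw [h, mul_zero])

/-- Subtractivity of a `2`-form in its second argument. [folklore] -/
theorem twoForm_sub_right (B : V [⋀^Fin 2]→L[ℝ] ℝ) (u v w : V) :
    B ![u, v - w] = B ![u, v] - B ![u, w] := by
  rw [cam₂_swap B u (v - w), twoForm_sub_left, cam₂_swap B v u, cam₂_swap B w u]
  ring

/-- Evaluation of a `2`-form at a pair, as a smooth function of the form and the pair. [folklore] -/
theorem contDiff_twoForm_apply_pair :
    ContDiff ℝ ∞ (fun q : (V [⋀^Fin 2]→L[ℝ] ℝ) × V × V ↦ q.1 ![q.2.1, q.2.2]) := by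
  have : (fun q : (V [⋀^Fin 2]→L[ℝ] ℝ) × V × V ↦ q.1 ![q.2.1, q.2.2]) =
      fun q ↦ alt2Flat q.1 q.2.1 q.2.2 := by
    funext q; rw [alt2Flat_apply]
  rw [this]
  exact ((contDiff_alt2Flat.comp contDiff_fst).clm_apply contDiff_snd.fst).clm_apply
    contDiff_snd.snd

/-- **`(B, t₀, t₁) ↦ P` is `C^∞` wherever `B(t₀, t₁) ≠ 0`.** [folklore] -/
theorem contDiffAt_symProjOf {q : (V [⋀^Fin 2]→L[ℝ] ℝ) × V × V} (hq : q.1 ![q.2.1, q.2.2] ≠ 0) :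
    ContDiffAt ℝ ∞ (fun q : (V [⋀^Fin 2]→L[ℝ] ℝ) × V × V ↦ symProjOf q.1 q.2.1 q.2.2) q := by
  have hA : ∀ (g : (V [⋀^Fin 2]→L[ℝ] ℝ) × V × V → V), ContDiff ℝ ∞ g →
      ContDiff ℝ ∞ fun q : (V [⋀^Fin 2]→L[ℝ] ℝ) × V × V ↦ alt2Flat q.1 (g q) := fun g hg ↦
    (contDiff_alt2Flat.comp contDiff_fst).clm_apply hg
  have hB : ∀ (g h : (V [⋀^Fin 2]→L[ℝ] ℝ) × V × V → V), ContDiff ℝ ∞ g → ContDiff ℝ ∞ h →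
      ContDiff ℝ ∞ fun q : (V [⋀^Fin 2]→L[ℝ] ℝ) × V × V ↦
        (alt2Flat q.1 (g q)).smulRight (h q) := by
    intro g h hg hh
    have heq : (fun q : (V [⋀^Fin 2]→L[ℝ] ℝ) × V × V ↦ (alt2Flat q.1 (g q)).smulRight (h q)) =
        fun q ↦ ContinuousLinearMap.smulRightL ℝ V V (alt2Flat q.1 (g q)) (h q) := by
      funext q; rfl
    rw [heq]
    exact ((ContinuousLinearMap.smulRightL ℝ V V).contDiff.comp (hA g hg)).clm_apply hh
  have hsm : ContDiff ℝ ∞ fun q : (V [⋀^Fin 2]→L[ℝ] ℝ) × V × V ↦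
      (((alt2Flat q.1 q.2.1).smulRight q.2.2) - ((alt2Flat q.1 q.2.2).smulRight q.2.1)) :=
    (hB _ _ contDiff_snd.fst contDiff_snd.snd).sub (hB _ _ contDiff_snd.snd contDiff_snd.fst)
  exact (contDiff_twoForm_apply_pair.contDiffAt.inv hq).smul hsm.contDiffAt

end SymProj

namespace SurfaceTube

/-- **The set-up of McLean's Lemma 5.14 (`k = 1`) read in a Whitney embedding**: a smooth
closed `2`-form `s` on the `4`-manifold `N`, non-degenerate; a smooth map `e : N → V` into an
inner product space, injective with injective differential (a Whitney embedding); and a smooth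
injective immersion `b : S → N` of a surface which is `s`-symplectic.
[cite: Mclean2012, Lemma 5.14] -/
structure Setup (N : Type*) [TopologicalSpace N] [ChartedSpace (EuclideanSpace ℝ (Fin 4)) N]
    [IsManifold (𝓡 4) ∞ N] (S : Type*) [TopologicalSpace S]
    [ChartedSpace (EuclideanSpace ℝ (Fin 2)) S] [IsManifold (𝓡 2) ∞ S]
    (V : Type*) [NormedAddCommGroup V] [InnerProductSpace ℝ V] [FiniteDimensional ℝ V] where
  /-- the symplectic form -/
  s : MForm (𝓡 4) N ℝ 2
  /-- the Whitney embedding of the ambient manifold -/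
  e : N → V
  /-- the surface -/
  b : S → N
  hs : IsSmoothForm s
  hsc : IsClosedForm s
  hnd : ∀ (x : N) (v : TangentSpace (𝓡 4) x), v ≠ 0 → ∃ w, s x ![v, w] ≠ 0
  he : ContMDiff (𝓡 4) 𝓘(ℝ, V) ∞ e
  heinj : Injective e
  hde : ∀ x, Injective (mfderiv (𝓡 4) 𝓘(ℝ, V) e x)
  hb : ContMDiff (𝓡 2) (𝓡 4) ∞ b
  hbinj : Injective b
  hdb : ∀ y, Injective (mfderiv (𝓡 2) (𝓡 4) b y)
  hbs : ∀ (y : S) (v : TangentSpace (𝓡 2) y), v ≠ 0 → ∃ w : TangentSpace (𝓡 2) y,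
    s (b y) ![mfderiv (𝓡 2) (𝓡 4) b y v, mfderiv (𝓡 2) (𝓡 4) b y w] ≠ 0

variable {N : Type*} [TopologicalSpace N] [ChartedSpace (EuclideanSpace ℝ (Fin 4)) N]
  [IsManifold (𝓡 4) ∞ N] {S : Type*} [TopologicalSpace S] [ChartedSpace (EuclideanSpace ℝ (Fin 2)) S]
  [IsManifold (𝓡 2) ∞ S] {V : Type*} [NormedAddCommGroup V] [InnerProductSpace ℝ V]
  [FiniteDimensional ℝ V] (D : Setup N S V)

namespace Setup

/-! ### The surface in the ambient space and the tangent planes -/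

/-- The surface in the ambient space: `f = e ∘ b`. [folklore] -/
def f : S → V := D.e ∘ D.b

/-- Unfolding of `f`. [folklore] -/
theorem f_apply (y : S) : D.f y = D.e (D.b y) := rfl

/-- `f` is `C^∞`. [folklore] -/
theorem contMDiff_f : ContMDiff (𝓡 2) 𝓘(ℝ, V) ∞ D.f := D.he.comp D.hb

/-- `e` is differentiable. [folklore] -/
theorem mdifferentiableAt_e (x : N) : MDifferentiableAt (𝓡 4) 𝓘(ℝ, V) D.e x :=
  (D.he x).mdifferentiableAt (by simp)

/-- `b` is differentiable. [folklore] -/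
theorem mdifferentiableAt_b (y : S) : MDifferentiableAt (𝓡 2) (𝓡 4) D.b y :=
  (D.hb y).mdifferentiableAt (by simp)

/-- `f` is differentiable. [folklore] -/
theorem mdifferentiableAt_f (y : S) : MDifferentiableAt (𝓡 2) 𝓘(ℝ, V) D.f y :=
  (D.contMDiff_f y).mdifferentiableAt (by simp)

/-- Chain rule: `df = de ∘ db`. [folklore] -/
theorem mfderiv_f (y : S) :
    mfderiv (𝓡 2) 𝓘(ℝ, V) D.f y =
      (mfderiv (𝓡 4) 𝓘(ℝ, V) D.e (D.b y)).comp (mfderiv (𝓡 2) (𝓡 4) D.b y) :=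
  mfderiv_comp y (D.mdifferentiableAt_e _) (D.mdifferentiableAt_b y)

/-- Chain rule, applied form: `df v = de (db v)`. [folklore] -/
theorem mfderiv_f_apply (y : S) (v : TangentSpace (𝓡 2) y) :
    mfderiv (𝓡 2) 𝓘(ℝ, V) D.f y v =
      mfderiv (𝓡 4) 𝓘(ℝ, V) D.e (D.b y) (mfderiv (𝓡 2) (𝓡 4) D.b y v) := by
  rw [mfderiv_f]; rfl

/-- `f` is injective. [folklore] -/
theorem f_injective : Injective D.f := D.heinj.comp D.hbinj

/-- `df` is injective. [folklore] -/
theorem hdf (y : S) : Injective (mfderiv (𝓡 2) 𝓘(ℝ, V) D.f y) := by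
  rw [mfderiv_f]
  exact (D.hde _).comp (D.hdb y)

/-- The ambient tangent plane of `N` at `b y`: `TN y = de(T_{b y} N) ⊆ V`. [folklore] -/
def TN (y : S) : Submodule ℝ V := tangentPlane (𝓡 4) D.e (D.b y)

/-- The ambient tangent plane of the surface: `TS y = df(T_y S) ⊆ V`. [folklore] -/
def TS (y : S) : Submodule ℝ V := tangentPlane (𝓡 2) D.f y

/-- Membership in `TN y`. [folklore] -/
theorem mem_TN_iff {y : S} {v : V} :
    v ∈ D.TN y ↔ ∃ a : TangentSpace (𝓡 4) (D.b y), mfderiv (𝓡 4) 𝓘(ℝ, V) D.e (D.b y) a = v :=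
  Iff.rfl

/-- Membership in `TS y`. [folklore] -/
theorem mem_TS_iff {y : S} {v : V} :
    v ∈ D.TS y ↔ ∃ c : TangentSpace (𝓡 2) y, mfderiv (𝓡 2) 𝓘(ℝ, V) D.f y c = v := Iff.rfl

/-- `TS y ≤ TN y`. [folklore] -/
theorem TS_le_TN (y : S) : D.TS y ≤ D.TN y := by
  rintro v ⟨c, rfl⟩
  exact ⟨mfderiv (𝓡 2) (𝓡 4) D.b y c, (D.mfderiv_f_apply y c).symm⟩

/-- `dim TN = 4`. [folklore] -/
theorem finrank_TN (y : S) : finrank ℝ (D.TN y) = 4 :=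
  (LinearMap.finrank_range_of_inj (D.hde (D.b y))).trans finrank_euclideanSpace_fin

/-- `dim TS = 2`. [folklore] -/
theorem finrank_TS (y : S) : finrank ℝ (D.TS y) = 2 :=
  (LinearMap.finrank_range_of_inj (D.hdf y)).trans finrank_euclideanSpace_fin

/-- **The Euclidean normal plane of the surface inside the ambient tangent space**:
`F y = (TS y)ᗮ ⊓ TN y`. [folklore] -/
def F (y : S) : Submodule ℝ V := (D.TS y)ᗮ ⊓ D.TN y

/-- `dim F = 2`. [folklore] -/
theorem finrank_F (y : S) : finrank ℝ (D.F y) = 2 := by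
  haveI : FiniteDimensional ℝ (D.TN y) := inferInstance
  exact Submodule.finrank_add_inf_finrank_orthogonal' (D.TS_le_TN y)
    (by rw [D.finrank_TS, D.finrank_TN])

/-- `F y ≤ TN y`. [folklore] -/
theorem F_le_TN (y : S) : D.F y ≤ D.TN y := inf_le_right

/-- Membership in `F y`. [folklore] -/
theorem mem_F_iff {y : S} {v : V} : v ∈ D.F y ↔ v ∈ (D.TS y)ᗮ ∧ v ∈ D.TN y := Submodule.mem_inf

/-- The orthogonal projection `Q y` onto the normal plane `F y`. [folklore] -/
def Q (y : S) : V →L[ℝ] V := (D.F y).starProjection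

/-- Unfolding of `Q`. [folklore] -/
theorem Q_def (y : S) : D.Q y = (D.F y).starProjection := rfl

/-- The tangent projections are self-adjoint. [folklore] -/
theorem inner_tangentProj_left_eq_right {m : ℕ} {X : Type*} [TopologicalSpace X]
    [ChartedSpace (EuclideanSpace ℝ (Fin m)) X] (g : X → V) (x : X) (u v : V) :
    ⟪tangentProj (𝓡 m) g x u, v⟫ = ⟪u, tangentProj (𝓡 m) g x v⟫ :=
  Submodule.inner_starProjection_left_eq_right _ _ _

/-- **`Q = P^N - P^S`**: the orthogonal projection onto `F y = (TS y)ᗮ ⊓ TN y` is the difference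
of the tangent projections of `e` at `b y` and of `f` at `y` (as `TS ≤ TN`). [folklore] -/
theorem Q_apply (y : S) (v : V) :
    D.Q y v = tangentProj (𝓡 4) D.e (D.b y) v - tangentProj (𝓡 2) D.f y v := by
  apply Submodule.eq_starProjection_of_mem_of_inner_eq_zero
  · refine Submodule.mem_inf.2 ⟨?_, ?_⟩
    · -- orthogonal to `TS`
      rw [Submodule.mem_orthogonal]
      intro t ht
      rw [inner_sub_right, ← inner_tangentProj_left_eq_right, ← inner_tangentProj_left_eq_right,
        tangentProj_apply_of_mem (D.TS_le_TN y ht), tangentProj_apply_of_mem ht, sub_self]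
    · exact (D.TN y).sub_mem (tangentProj_apply_mem _ _ v)
        (D.TS_le_TN y (tangentProj_apply_mem _ _ v))
  · intro w hw
    have hw1 : w ∈ (D.TS y)ᗮ := (Submodule.mem_inf.1 hw).1
    have hw2 : w ∈ D.TN y := (Submodule.mem_inf.1 hw).2
    have h1 : ⟪v - tangentProj (𝓡 4) D.e (D.b y) v, w⟫ = 0 :=
      Submodule.inner_left_of_mem_orthogonal hw2 (sub_tangentProj_apply_mem_orthogonal _ _ v)
    have h2 : ⟪tangentProj (𝓡 2) D.f y v, w⟫ = 0 :=
      Submodule.inner_right_of_mem_orthogonal (tangentProj_apply_mem _ _ v) hw1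
    rw [sub_sub_eq_add_sub, add_sub_right_comm, inner_add_left, h1, h2, add_zero]

/-- `Q` as a difference of the two tangent-projection fields. [folklore] -/
theorem Q_eq : D.Q = fun y ↦ tangentProj (𝓡 4) D.e (D.b y) - tangentProj (𝓡 2) D.f y := by
  funext y
  ext v
  exact D.Q_apply y v

/-- **`y ↦ Q y` is `C^∞`.** [folklore] -/
theorem contMDiff_Q : ContMDiff (𝓡 2) 𝓘(ℝ, V →L[ℝ] V) ∞ D.Q := by
  rw [Q_eq]
  exact ((contMDiff_tangentProj D.he D.hde).comp D.hb).sub (contMDiff_tangentProj D.contMDiff_f D.hdf)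

/-- `y ↦ Q y` is continuous. [folklore] -/
theorem continuous_Q : Continuous D.Q := D.contMDiff_Q.continuous

/-- `Q y v ∈ F y`. [folklore] -/
theorem Q_apply_mem (y : S) (v : V) : D.Q y v ∈ D.F y := Submodule.starProjection_apply_mem _ v

/-- `Q y v = v ↔ v ∈ F y`. [folklore] -/
theorem Q_apply_eq_self_iff {y : S} {v : V} : D.Q y v = v ↔ v ∈ D.F y :=
  Submodule.starProjection_eq_self_iff

/-- `Q` kills `TS`. [folklore] -/
theorem Q_apply_eq_zero_of_mem_TS {y : S} {t : V} (ht : t ∈ D.TS y) : D.Q y t = 0 := by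
  rw [Q_apply, tangentProj_apply_of_mem (D.TS_le_TN y ht), tangentProj_apply_of_mem ht, sub_self]

/-- `Q` kills `(TN)ᗮ`. [folklore] -/
theorem Q_apply_eq_zero_of_mem_TN_orthogonal {y : S} {u : V} (hu : u ∈ (D.TN y)ᗮ) :
    D.Q y u = 0 := by
  have hu' : u ∈ (D.TS y)ᗮ := Submodule.orthogonal_le (D.TS_le_TN y) hu
  rw [Q_apply, tangentProj_apply_eq_zero_of_mem_orthogonal hu,
    tangentProj_apply_eq_zero_of_mem_orthogonal hu', sub_self]

/-- **Orthogonal decomposition of the ambient tangent space**: `v = P^S v + Q v` for `v ∈ TN`.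
[folklore] -/
theorem tangentProj_add_Q_apply {y : S} {v : V} (hv : v ∈ D.TN y) :
    tangentProj (𝓡 2) D.f y v + D.Q y v = v := by
  rw [Q_apply, tangentProj_apply_of_mem hv, add_sub_cancel]

/-! ### The ambient symplectic form along the surface -/

/-- The symplectic form read in the ambient space at the points of the surface:
`Sf y = s.ambient e (b y)`. [folklore] -/
def Sf (y : S) : V [⋀^Fin 2]→L[ℝ] ℝ := D.s.ambient D.e (D.b y)

/-- **`y ↦ Sf y` is `C^∞`.** [folklore] -/
theorem contMDiff_Sf : ContMDiff (𝓡 2) 𝓘(ℝ, V [⋀^Fin 2]→L[ℝ] ℝ) ∞ D.Sf :=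
  (MForm.contMDiff_ambient D.hs D.he D.hde).comp D.hb

/-- `y ↦ Sf y` is continuous. [folklore] -/
theorem continuous_Sf : Continuous D.Sf := D.contMDiff_Sf.continuous

/-- `Sf` evaluates `s` on tangent vectors of `N`. [folklore] -/
theorem Sf_apply_mfderiv (y : S) (v w : TangentSpace (𝓡 4) (D.b y)) :
    D.Sf y ![mfderiv (𝓡 4) 𝓘(ℝ, V) D.e (D.b y) v, mfderiv (𝓡 4) 𝓘(ℝ, V) D.e (D.b y) w] =
      D.s (D.b y) ![v, w] := by
  have h := D.s.ambient_apply_mfderiv (D.mdifferentiableAt_e (D.b y)) (D.hde (D.b y)) ![v, w]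
  rw [Sf, ← h]
  congr 1
  funext i
  fin_cases i <;> rfl

/-- `Sf` evaluates `s` on tangent vectors of the surface. [folklore] -/
theorem Sf_apply_mfderiv_f (y : S) (c d : TangentSpace (𝓡 2) y) :
    D.Sf y ![mfderiv (𝓡 2) 𝓘(ℝ, V) D.f y c, mfderiv (𝓡 2) 𝓘(ℝ, V) D.f y d] =
      D.s (D.b y) ![mfderiv (𝓡 2) (𝓡 4) D.b y c, mfderiv (𝓡 2) (𝓡 4) D.b y d] := by
  rw [mfderiv_f_apply, mfderiv_f_apply, Sf_apply_mfderiv]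

/-- `Sf` vanishes as soon as one argument is normal to `TN`. [folklore] -/
theorem Sf_apply_eq_zero_left {y : S} {u : V} (hu : u ∈ (D.TN y)ᗮ) (w : V) :
    D.Sf y ![u, w] = 0 :=
  D.s.ambient_apply_eq_zero_of_mem_orthogonal (D.mdifferentiableAt_e _) (u := ![u, w]) (i := 0) hu

/-- `Sf` vanishes when the second argument is normal to `TN`. [folklore] -/
theorem Sf_apply_eq_zero_right {y : S} (v : V) {u : V} (hu : u ∈ (D.TN y)ᗮ) :
    D.Sf y ![v, u] = 0 :=
  D.s.ambient_apply_eq_zero_of_mem_orthogonal (D.mdifferentiableAt_e _) (u := ![v, u]) (i := 1) hu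

/-- `Sf` factors through the tangent projection `P^N`. [folklore] -/
theorem Sf_apply_tangentProj (y : S) (v w : V) :
    D.Sf y ![tangentProj (𝓡 4) D.e (D.b y) v, tangentProj (𝓡 4) D.e (D.b y) w] = D.Sf y ![v, w] := by
  have h := D.s.ambient_apply_tangentProj (D.mdifferentiableAt_e (D.b y)) (D.hde (D.b y)) ![v, w]
  rw [Sf, ← h]
  congr 1
  funext i
  fin_cases i <;> rfl

/-- **`Sf` is non-degenerate on `TN`.** [folklore] -/
theorem exists_Sf_ne_zero_of_mem_TN {y : S} {v : V} (hv : v ∈ D.TN y) (hv0 : v ≠ 0) :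
    ∃ w ∈ D.TN y, D.Sf y ![v, w] ≠ 0 := by
  obtain ⟨a, rfl⟩ := hv
  have ha : a ≠ 0 := by
    rintro rfl; exact hv0 (map_zero _)
  obtain ⟨c, hc⟩ := D.hnd (D.b y) a ha
  refine ⟨mfderiv (𝓡 4) 𝓘(ℝ, V) D.e (D.b y) c, ⟨c, rfl⟩, ?_⟩
  show D.Sf y ![mfderiv (𝓡 4) 𝓘(ℝ, V) D.e (D.b y) a, mfderiv (𝓡 4) 𝓘(ℝ, V) D.e (D.b y) c] ≠ 0
  rwa [Sf_apply_mfderiv]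

/-! ### The symplectic projection onto the tangent planes of the surface -/

/-- The coordinate tangent frame `tvec y i = df_y(eᵢ)` of the surface at `y` (w.r.t. the chart
at `y`; only its span `TS y` matters). [folklore] -/
def tvec (y : S) (i : Fin 2) : V :=
  mfderiv (𝓡 2) 𝓘(ℝ, V) D.f y (EuclideanSpace.single i (1 : ℝ))

/-- The frame vectors are tangent to the surface. [folklore] -/
theorem tvec_mem_TS (y : S) (i : Fin 2) : D.tvec y i ∈ D.TS y := ⟨_, rfl⟩

/-- Decomposition of a vector of `ℝ²` in the standard basis. [folklore] -/
theorem euclideanSpace_fin_two_eq (c : EuclideanSpace ℝ (Fin 2)) :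
    c = c 0 • EuclideanSpace.single 0 (1 : ℝ) + c 1 • EuclideanSpace.single 1 (1 : ℝ) := by
  ext i
  fin_cases i <;> simp

/-- `df_y(c) = c₀ tvec y 0 + c₁ tvec y 1` (stated for `c` in the model `ℝ²`, to which the
tangent space `T_y S` is definitionally equal). [folklore] -/
theorem mfderiv_f_eq_tvec (y : S) (c : EuclideanSpace ℝ (Fin 2)) :
    mfderiv (𝓡 2) 𝓘(ℝ, V) D.f y c = c 0 • D.tvec y 0 + c 1 • D.tvec y 1 := by
  have hL : ∀ (a d : ℝ) (u w : TangentSpace (𝓡 2) y),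
      mfderiv (𝓡 2) 𝓘(ℝ, V) D.f y (a • u + d • w) =
        a • mfderiv (𝓡 2) 𝓘(ℝ, V) D.f y u + d • mfderiv (𝓡 2) 𝓘(ℝ, V) D.f y w := by
    intro a d u w
    rw [map_add, map_smul, map_smul]
  exact (congrArg (mfderiv (𝓡 2) 𝓘(ℝ, V) D.f y) (euclideanSpace_fin_two_eq c)).trans
    (hL (c 0) (c 1) _ _)

/-- **`TS y` is spanned by the frame.** [folklore] -/
theorem TS_eq_span (y : S) : D.TS y = Submodule.span ℝ {D.tvec y 0, D.tvec y 1} := by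
  refine le_antisymm ?_ (Submodule.span_le.2 ?_)
  · rintro v ⟨c, rfl⟩
    rw [mem_span_pair_iff]
    exact ⟨_, _, D.mfderiv_f_eq_tvec y c⟩
  · rintro v hv
    simp only [Set.mem_insert_iff, Set.mem_singleton_iff] at hv
    rcases hv with rfl | rfl
    exacts [D.tvec_mem_TS y 0, D.tvec_mem_TS y 1]

/-- **The symplectic form does not vanish on the frame** (the surface is symplectic). [folklore] -/
theorem Sf_tvec_ne_zero (y : S) : D.Sf y ![D.tvec y 0, D.tvec y 1] ≠ 0 := by
  have h0 : (EuclideanSpace.single 0 (1 : ℝ) : EuclideanSpace ℝ (Fin 2)) ≠ 0 := by simp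
  obtain ⟨w, hw⟩ := D.hbs y (EuclideanSpace.single 0 (1 : ℝ)) h0
  intro h
  apply hw
  rw [← Sf_apply_mfderiv_f, mfderiv_f_eq_tvec, mfderiv_f_eq_tvec, twoForm_pair_eq, h, mul_zero]

/-- **The symplectic projection** `symProj y : V →L V` onto `TS y` along its `Sf y`-annihilator
(well defined as `TS y` is symplectic). [cite: McDuffSalamon2017, Lemma 2.1.1] -/
def symProj (y : S) : V →L[ℝ] V := symProjOf (D.Sf y) (D.tvec y 0) (D.tvec y 1)

/-- Unfolding of `symProj`. [folklore] -/
theorem symProj_def (y : S) : D.symProj y = symProjOf (D.Sf y) (D.tvec y 0) (D.tvec y 1) := rfl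

/-- `symProj y v ∈ TS y`. [folklore] -/
theorem symProj_apply_mem (y : S) (v : V) : D.symProj y v ∈ D.TS y := by
  rw [TS_eq_span]; exact symProjOf_apply_mem _ _ _ v

/-- **`v - symProj y v` is `Sf`-orthogonal to `TS y`.** [folklore] -/
theorem Sf_sub_symProj_apply (y : S) (v : V) {t : V} (ht : t ∈ D.TS y) :
    D.Sf y ![v - D.symProj y v, t] = 0 := by
  rw [TS_eq_span] at ht
  exact twoForm_sub_symProjOf_of_mem _ (D.Sf_tvec_ne_zero y) v ht

/-- `TS y` is `Sf`-orthogonal to `v - symProj y v` (swapped form). [folklore] -/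
theorem Sf_sub_symProj_apply' (y : S) {t : V} (ht : t ∈ D.TS y) (v : V) :
    D.Sf y ![t, v - D.symProj y v] = 0 := by
  rw [cam₂_swap, D.Sf_sub_symProj_apply y v ht, neg_zero]

/-- `symProj y` is the identity on `TS y`. [folklore] -/
theorem symProj_apply_of_mem {y : S} {t : V} (ht : t ∈ D.TS y) : D.symProj y t = t := by
  rw [TS_eq_span] at ht
  exact symProjOf_apply_of_mem _ (D.Sf_tvec_ne_zero y) ht

/-- `symProj y` is idempotent. [folklore] -/
theorem symProj_symProj_apply (y : S) (v : V) : D.symProj y (D.symProj y v) = D.symProj y v :=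
  D.symProj_apply_of_mem (D.symProj_apply_mem y v)

/-- `symProj y` fixes the tangent vectors `df c`. [folklore] -/
theorem symProj_mfderiv_f (y : S) (c : TangentSpace (𝓡 2) y) :
    D.symProj y (mfderiv (𝓡 2) 𝓘(ℝ, V) D.f y c) = mfderiv (𝓡 2) 𝓘(ℝ, V) D.f y c :=
  D.symProj_apply_of_mem ⟨c, rfl⟩

/-- **Uniqueness**: an element `p ∈ TS y` with `v - p` `Sf`-orthogonal to `TS y` is `symProj y v`.
[folklore] -/
theorem eq_symProj_apply {y : S} {v p : V} (hp : p ∈ D.TS y)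
    (h : ∀ t ∈ D.TS y, D.Sf y ![v - p, t] = 0) : p = D.symProj y v := by
  have hp' := hp
  rw [TS_eq_span] at hp'
  exact eq_symProjOf_apply _ (D.Sf_tvec_ne_zero y) hp' (h _ (D.tvec_mem_TS y 0))
    (h _ (D.tvec_mem_TS y 1))

/-- `v - symProj y v = 0` forces `v ∈ TS y`. [folklore] -/
theorem mem_TS_of_sub_symProj_eq_zero {y : S} {v : V} (h : v - D.symProj y v = 0) : v ∈ D.TS y := by
  rw [sub_eq_zero] at h
  rw [h]
  exact D.symProj_apply_mem y v

/-- **`y ↦ symProj y` is `C^∞`** (locally it is `symProjOf` of the smooth data `Sf` and the chart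
frame `D(f ∘ φ⁻¹)(φ y) eᵢ`, by frame independence). [folklore] -/
theorem contMDiff_symProj : ContMDiff (𝓡 2) 𝓘(ℝ, V →L[ℝ] V) ∞ D.symProj := by
  intro p
  -- the chart frame
  let fr : S → (V [⋀^Fin 2]→L[ℝ] ℝ) × V × V := fun y ↦
    (D.Sf y, chartDeriv (𝓡 2) D.f p (extChartAt (𝓡 2) p y) (EuclideanSpace.single 0 (1 : ℝ)),
      chartDeriv (𝓡 2) D.f p (extChartAt (𝓡 2) p y) (EuclideanSpace.single 1 (1 : ℝ)))
  have hspan : ∀ y ∈ (extChartAt (𝓡 2) p).source,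
      D.TS y = Submodule.span ℝ {(fr y).2.1, (fr y).2.2} := by
    intro y hy
    have h := tangentPlane_eq_range_chartDeriv hy (D.mdifferentiableAt_f y)
    change D.TS y = _ at h
    rw [h]
    refine le_antisymm ?_ (Submodule.span_le.2 ?_)
    · rintro v ⟨c, rfl⟩
      rw [mem_span_pair_iff]
      refine ⟨c 0, c 1, ?_⟩
      show chartDeriv (𝓡 2) D.f p (extChartAt (𝓡 2) p y) c = _
      conv_lhs => rw [euclideanSpace_fin_two_eq c]
      rw [map_add, map_smul, map_smul]
    · rintro v hv
      simp only [Set.mem_insert_iff, Set.mem_singleton_iff] at hv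
      rcases hv with rfl | rfl
      exacts [⟨_, rfl⟩, ⟨_, rfl⟩]
  have hmem : ∀ y ∈ (extChartAt (𝓡 2) p).source, ∀ i : Fin 2,
      D.tvec y i ∈ Submodule.span ℝ {(fr y).2.1, (fr y).2.2} := fun y hy i ↦ by
    rw [← hspan y hy]; exact D.tvec_mem_TS y i
  have hmem' : ∀ y ∈ (extChartAt (𝓡 2) p).source,
      (fr y).2.1 ∈ Submodule.span ℝ {D.tvec y 0, D.tvec y 1} ∧
        (fr y).2.2 ∈ Submodule.span ℝ {D.tvec y 0, D.tvec y 1} := fun y hy ↦ by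
    rw [← TS_eq_span, hspan y hy]
    exact ⟨Submodule.subset_span (by simp), Submodule.subset_span (by simp)⟩
  have hne : ∀ y ∈ (extChartAt (𝓡 2) p).source, (fr y).1 ![(fr y).2.1, (fr y).2.2] ≠ 0 :=
    fun y hy ↦ twoForm_ne_zero_of_mem_span _ (D.Sf_tvec_ne_zero y) (hmem y hy 0) (hmem y hy 1)
  -- local formula
  have heq : ∀ y ∈ (extChartAt (𝓡 2) p).source, D.symProj y =
      ((fun q : (V [⋀^Fin 2]→L[ℝ] ℝ) × V × V ↦ symProjOf q.1 q.2.1 q.2.2) ∘ fr) y := by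
    intro y hy
    ext v
    exact (symProjOf_eq_of_mem_span _ (D.Sf_tvec_ne_zero y) (hne y hy) (hmem' y hy).1
      (hmem' y hy).2 (hmem y hy 0) (hmem y hy 1) v).symm
  -- smoothness of the frame data on the chart domain
  have hφ : ContMDiffOn (𝓡 2) 𝓘(ℝ, EuclideanSpace ℝ (Fin 2)) ∞ (extChartAt (𝓡 2) p)
      (extChartAt (𝓡 2) p).source := by
    rw [extChartAt_source]; exact contMDiffOn_extChartAt
  have hcd : ContMDiffOn (𝓡 2) 𝓘(ℝ, EuclideanSpace ℝ (Fin 2) →L[ℝ] V) ∞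
      (chartDeriv (𝓡 2) D.f p ∘ extChartAt (𝓡 2) p) (extChartAt (𝓡 2) p).source :=
    (contDiffOn_chartDeriv D.contMDiff_f p).contMDiffOn.comp hφ
      fun x hx ↦ (extChartAt (𝓡 2) p).map_source hx
  have hfr : ContMDiffOn (𝓡 2) 𝓘(ℝ, (V [⋀^Fin 2]→L[ℝ] ℝ) × V × V) ∞ fr
      (extChartAt (𝓡 2) p).source :=
    D.contMDiff_Sf.contMDiffOn.prodMk_space
      ((hcd.clm_apply contMDiffOn_const).prodMk_space (hcd.clm_apply contMDiffOn_const))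
  have h2 : ContMDiffOn (𝓡 2) 𝓘(ℝ, V →L[ℝ] V) ∞
      ((fun q : (V [⋀^Fin 2]→L[ℝ] ℝ) × V × V ↦ symProjOf q.1 q.2.1 q.2.2) ∘ fr)
      (extChartAt (𝓡 2) p).source := fun y hy ↦
    (contDiffAt_symProjOf (hne y hy)).comp_contMDiffWithinAt (hfr y hy)
  exact (h2.congr heq).contMDiffAt (extChartAt_source_mem_nhds p)

/-- `y ↦ symProj y` is continuous. [folklore] -/
theorem continuous_symProj : Continuous D.symProj := D.contMDiff_symProj.continuous

/-! ### The normal symplectic form -/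

/-- **The normal part of the symplectic form**: `o y := Sf y ∘ Λ²(1 - symProj y)`,
`o(v, w) = Sf(v - Pˢ v, w - Pˢ w)` with `Pˢ = symProj y`; restricted to the Euclidean normal plane
`F y ≅ TS^ω` it is the symplectic form of the symplectic normal bundle.
[cite: McDuffSalamon2017, Lemma 2.1.1 / Thm. 3.4.10] -/
def o (y : S) : V [⋀^Fin 2]→L[ℝ] ℝ :=
  (D.Sf y).compContinuousLinearMap (ContinuousLinearMap.id ℝ V - D.symProj y)

/-- Unfolding of `o`. [folklore] -/
theorem o_apply (y : S) (v w : V) :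
    D.o y ![v, w] = D.Sf y ![v - D.symProj y v, w - D.symProj y w] := by
  rw [o, ContinuousAlternatingMap.compContinuousLinearMap_apply]
  congr 1
  funext i
  fin_cases i <;> rfl

/-- `o(v, w) = Sf(v - Pˢ v, w)`. [folklore] -/
theorem o_apply_left (y : S) (v w : V) : D.o y ![v, w] = D.Sf y ![v - D.symProj y v, w] := by
  rw [o_apply, twoForm_sub_right, D.Sf_sub_symProj_apply y v (D.symProj_apply_mem y w), sub_zero]

/-- `o` vanishes as soon as one argument is tangent to the surface. [folklore] -/
theorem o_apply_eq_zero_of_mem_TS {y : S} {t : V} (ht : t ∈ D.TS y) (w : V) : D.o y ![t, w] = 0 := by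
  rw [o_apply_left, D.symProj_apply_of_mem ht, sub_self, twoForm_zero_left]

/-- **Block decomposition of the symplectic form along the surface**:
`Sf(v₁, v₂) = Sf(Pˢ v₁, Pˢ v₂) + o(v₁, v₂)` (`Pˢ = symProj y`; the mixed terms vanish since
`vᵢ - Pˢ vᵢ` is `Sf`-orthogonal to `TS y`). [folklore] -/
theorem Sf_apply_eq_add_o (y : S) (v₁ v₂ : V) :
    D.Sf y ![v₁, v₂] = D.Sf y ![D.symProj y v₁, D.symProj y v₂] + D.o y ![v₁, v₂] := by
  have h1 : D.Sf y ![v₁, v₂] =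
      D.Sf y ![v₁ - D.symProj y v₁, v₂] + D.Sf y ![D.symProj y v₁, v₂] := by
    rw [← cam₂_add_left, sub_add_cancel]
  have h2 : D.Sf y ![D.symProj y v₁, v₂] =
      D.Sf y ![D.symProj y v₁, v₂ - D.symProj y v₂] +
        D.Sf y ![D.symProj y v₁, D.symProj y v₂] := by
    rw [← cam₂_add_right, sub_add_cancel]
  rw [h1, h2, D.Sf_sub_symProj_apply' y (D.symProj_apply_mem y v₁), zero_add, o_apply_left,
    add_comm]

/-- `o` only sees the normal components: `o(Q v, Q w) = o(v, w)` for `v, w ∈ TN y`. [folklore] -/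
theorem o_apply_Q (y : S) {v w : V} (hv : v ∈ D.TN y) (hw : w ∈ D.TN y) :
    D.o y ![D.Q y v, D.Q y w] = D.o y ![v, w] := by
  have hv' := D.tangentProj_add_Q_apply hv
  have hw' := D.tangentProj_add_Q_apply hw
  conv_rhs => rw [← hv', ← hw']
  rw [cam₂_add_left, D.o_apply_eq_zero_of_mem_TS (tangentProj_apply_mem _ _ v), zero_add,
    cam₂_add_right, cam₂_swap (D.o y) _ (tangentProj (𝓡 2) D.f y w),
    D.o_apply_eq_zero_of_mem_TS (tangentProj_apply_mem _ _ w), neg_zero, zero_add]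

omit [FiniteDimensional ℝ V] in
/-- Pull-backs of `2`-forms depend smoothly on the pair. [folklore] -/
theorem contDiff_compContinuousLinearMap_prod :
    ContDiff ℝ ∞ (fun q : (V [⋀^Fin 2]→L[ℝ] ℝ) × (V →L[ℝ] V) ↦
      q.1.compContinuousLinearMap q.2) :=
  contDiff_iff_contDiffAt.2 fun _ ↦
    Literature.NumberTheory.Transcendental.ContDiffAt.continuousAlternatingMapCompContinuousLinearMap
      contDiffAt_fst contDiffAt_snd

/-- **`y ↦ o y` is `C^∞`.** [folklore] -/
theorem contMDiff_o : ContMDiff (𝓡 2) 𝓘(ℝ, V [⋀^Fin 2]→L[ℝ] ℝ) ∞ D.o :=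
  contDiff_compContinuousLinearMap_prod.comp_contMDiff
    (D.contMDiff_Sf.prodMk_space (contMDiff_const.sub D.contMDiff_symProj))

/-- `y ↦ o y` is continuous. [folklore] -/
theorem continuous_o : Continuous D.o := D.contMDiff_o.continuous

/-- **`o` does not vanish on the normal plane** (`F y ≅ TS^ω` is symplectic since `TN` and `TS`
are). [cite: McDuffSalamon2017, Lemma 2.1.1] -/
theorem exists_o_ne_zero (y : S) : ∃ v w, D.o y ![D.Q y v, D.Q y w] ≠ 0 := by
  by_contra! h
  -- a nonzero normal vector
  obtain ⟨m, hmF, hm0⟩ : ∃ m ∈ D.F y, m ≠ 0 := by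
    have hpos : 0 < finrank ℝ (D.F y) := by rw [D.finrank_F]; norm_num
    obtain ⟨m, hm⟩ := finrank_pos_iff_exists_ne_zero.1 hpos
    exact ⟨m, m.2, fun h0 ↦ hm (Subtype.ext h0)⟩
  have hgTN : m - D.symProj y m ∈ D.TN y :=
    (D.TN y).sub_mem (D.F_le_TN y hmF) (D.TS_le_TN y (D.symProj_apply_mem y m))
  have hg0 : m - D.symProj y m ≠ 0 := by
    intro hg0
    have hmTS : m ∈ D.TS y := D.mem_TS_of_sub_symProj_eq_zero hg0
    have hmorth : m ∈ (D.TS y)ᗮ := (D.mem_F_iff.1 hmF).1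
    exact hm0 (inner_self_eq_zero.1 (Submodule.inner_right_of_mem_orthogonal hmTS hmorth))
  obtain ⟨w, hwTN, hw⟩ := D.exists_Sf_ne_zero_of_mem_TN hgTN hg0
  apply hw
  have hsplit := D.tangentProj_add_Q_apply hwTN
  calc D.Sf y ![m - D.symProj y m, w]
      = D.Sf y ![m - D.symProj y m, tangentProj (𝓡 2) D.f y w] +
          D.Sf y ![m - D.symProj y m, D.Q y w] := by
        conv_lhs => rw [← hsplit]
        rw [cam₂_add_right]
    _ = D.o y ![D.Q y m, D.Q y w] := by
        rw [D.Sf_sub_symProj_apply y m (tangentProj_apply_mem _ _ w), zero_add, o_apply_left,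
          D.Q_apply_eq_self_iff.2 hmF]
    _ = 0 := h _ _

/-! ### The rotation of the normal planes and the area factor -/

/-- **The compressed operator `Ω y = Q A_o Q` of `o y` on the normal plane** (`⟪Ω v, w⟫ =
o(Q v, Q w)`); `Ω = K J`. [folklore] -/
def Om (y : S) : V →L[ℝ] V := planeOp (D.Q y) (D.o y)

/-- **The rotation by `+π/2` of the normal planes**, positive for `o`:
`J y := planeRot (Q y) (o y)`. [cite: McDuffSalamon2017, Prop. 2.5.6] -/
def J (y : S) : V →L[ℝ] V := planeRot (D.Q y) (D.o y)

/-- **The area factor** `K y := √(a²) = |α| > 0`, with `Ω = K J` and `o(Q v, J v) = K ‖Q v‖²`.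
[folklore] -/
def K (y : S) : ℝ := Real.sqrt (planeRotSq (D.Q y) (D.o y))

/-- `Om` in terms of the orthogonal projection onto `F y`. [folklore] -/
theorem Om_def (y : S) : D.Om y = planeOp (D.F y).starProjection (D.o y) := rfl

/-- `J` in terms of the orthogonal projection onto `F y`. [folklore] -/
theorem J_def (y : S) : D.J y = planeRot (D.F y).starProjection (D.o y) := rfl

/-- `K` in terms of the orthogonal projection onto `F y`. [folklore] -/
theorem K_def (y : S) : D.K y = Real.sqrt (planeRotSq (D.F y).starProjection (D.o y)) := rfl

/-- `a² > 0`: the form `o y` does not vanish on the normal plane. [folklore] -/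
theorem planeRotSq_pos (y : S) : 0 < planeRotSq (D.Q y) (D.o y) :=
  (planeRotSq_pos_iff (D.finrank_F y) _).2 (D.exists_o_ne_zero y)

/-- `K = |α|`. [folklore] -/
theorem K_eq_abs (y : S) : D.K y = |planeCoeff (D.finrank_F y) (D.o y)| := sqrt_planeRotSq _ _

/-- `K > 0`. [folklore] -/
theorem K_pos (y : S) : 0 < D.K y := Real.sqrt_pos.2 (D.planeRotSq_pos y)

/-- `Ω v = K J v`. [folklore] -/
theorem Om_apply (y : S) (v : V) : D.Om y v = D.K y • D.J y v := by
  rw [J, planeRot_def_apply, smul_smul, K, mul_inv_cancel₀ (Real.sqrt_pos.2 (D.planeRotSq_pos y)).ne',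
    one_smul]
  rfl

/-- `Ω = K J`. [folklore] -/
theorem Om_eq (y : S) : D.Om y = D.K y • D.J y := by
  ext v
  exact D.Om_apply y v

/-- `⟪Ω v, w⟫ = o(Q v, Q w)`. [folklore] -/
theorem inner_Om_left (y : S) (v w : V) : ⟪D.Om y v, w⟫ = D.o y ![D.Q y v, D.Q y w] :=
  inner_planeOp_left _ _ v w

/-- **`o(Q v, Q w) = K ⟪J v, w⟫`**: on the normal plane the symplectic form is `K` times the
Euclidean area form turned by `J`. [folklore] -/
theorem o_apply_Q_eq (y : S) (v w : V) : D.o y ![D.Q y v, D.Q y w] = D.K y * ⟪D.J y v, w⟫ := by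
  rw [← inner_Om_left, Om_apply, real_inner_smul_left]

/-- `y ↦ Ω y` is smooth. [folklore] -/
theorem contMDiff_Om : ContMDiff (𝓡 2) 𝓘(ℝ, V →L[ℝ] V) ∞ D.Om :=
  contDiff_planeOp.comp_contMDiff (D.contMDiff_Q.prodMk_space D.contMDiff_o)

/-- **`y ↦ J y` is smooth.** [folklore] -/
theorem contMDiff_J : ContMDiff (𝓡 2) 𝓘(ℝ, V →L[ℝ] V) ∞ D.J := by
  intro y
  have hQo : ContMDiffAt (𝓡 2) 𝓘(ℝ, (V →L[ℝ] V) × (V [⋀^Fin 2]→L[ℝ] ℝ)) ∞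
      (fun y ↦ (D.Q y, D.o y)) y := (D.contMDiff_Q.prodMk_space D.contMDiff_o) y
  exact ContDiffAt.comp_contMDiffAt (x := y) (f := fun y' ↦ (D.Q y', D.o y'))
    (contDiffAt_planeRot (D.planeRotSq_pos y)) hQo

/-- `y ↦ K y` is smooth. [folklore] -/
theorem contMDiff_K : ContMDiff (𝓡 2) 𝓘(ℝ, ℝ) ∞ D.K := by
  intro y
  have h1 : ContMDiffAt (𝓡 2) 𝓘(ℝ, ℝ) ∞ (fun y ↦ planeRotSq (D.Q y) (D.o y)) y :=
    contDiff_planeRotSq.comp_contMDiff (D.contMDiff_Q.prodMk_space D.contMDiff_o) y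
  have h2 : ContDiffAt ℝ ∞ Real.sqrt (planeRotSq (D.Q y) (D.o y)) :=
    Real.contDiffAt_sqrt (D.planeRotSq_pos y).ne'
  exact ContDiffAt.comp_contMDiffAt (x := y) (f := fun y' ↦ planeRotSq (D.Q y') (D.o y')) h2 h1

/-- `y ↦ J y` is continuous. [folklore] -/
theorem continuous_J : Continuous D.J := D.contMDiff_J.continuous

/-- `y ↦ K y` is continuous. [folklore] -/
theorem continuous_K : Continuous D.K := D.contMDiff_K.continuous

/-! ### Identities of `Q` and `J`: `J² = -Q`, `J` skew, `QJ = JQ = J`, `‖J v‖ = ‖Q v‖` -/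

/-- **`J² = -Q`.** [cite: McDuffSalamon2017, Prop. 2.5.6 (2.5.14)] -/
theorem J_J_apply (y : S) (v : V) : D.J y (D.J y v) = -D.Q y v :=
  planeRot_planeRot_apply (D.finrank_F y) (D.exists_o_ne_zero y) v

/-- `J` takes values in the normal plane. [folklore] -/
theorem J_apply_mem (y : S) (v : V) : D.J y v ∈ D.F y := planeRot_apply_mem v

/-- `Q J = J`. [folklore] -/
theorem Q_J_apply (y : S) (v : V) : D.Q y (D.J y v) = D.J y v := starProjection_planeRot_apply v

/-- `J Q = J`. [folklore] -/
theorem J_Q_apply (y : S) (v : V) : D.J y (D.Q y v) = D.J y v := planeRot_starProjection_apply v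

/-- `J` is skew-adjoint. [folklore] -/
theorem inner_J_left_eq_neg (y : S) (v w : V) : ⟪D.J y v, w⟫ = -⟪v, D.J y w⟫ :=
  inner_planeRot_left_eq_neg v w

/-- `⟪J v, v⟫ = 0`. [folklore] -/
theorem inner_J_self (y : S) (v : V) : ⟪D.J y v, v⟫ = 0 := inner_planeRot_self v

/-- `⟪J v, J w⟫ = ⟪Q v, Q w⟫`: `J` is a partial isometry with initial space `F y`. [folklore] -/
theorem inner_J_J (y : S) (v w : V) : ⟪D.J y v, D.J y w⟫ = ⟪D.Q y v, D.Q y w⟫ :=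
  inner_planeRot_planeRot (D.finrank_F y) (D.exists_o_ne_zero y) v w

/-- `‖J v‖ = ‖Q v‖`. [folklore] -/
theorem norm_J (y : S) (v : V) : ‖D.J y v‖ = ‖D.Q y v‖ :=
  norm_planeRot (D.finrank_F y) (D.exists_o_ne_zero y) v

/-- `J v = 0 ↔ Q v = 0`. [folklore] -/
theorem J_apply_eq_zero_iff (y : S) (v : V) : D.J y v = 0 ↔ D.Q y v = 0 :=
  planeRot_apply_eq_zero_iff (D.finrank_F y) (D.exists_o_ne_zero y) v

/-- **Positivity: `o(Q v, J v) = K ‖Q v‖²`.** [cite: McDuffSalamon2017, Prop. 2.5.6 (2.5.14)] -/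
theorem o_Q_J (y : S) (v : V) : D.o y ![D.Q y v, D.J y v] = D.K y * ‖D.Q y v‖ ^ 2 := by
  rw [J_def, K_eq_abs]; exact twoForm_planeRot_eq (D.finrank_F y) v

/-- `J` kills the tangent plane of the surface and the normal space of `N`. [folklore] -/
theorem J_apply_eq_zero_of_mem_TS {y : S} {t : V} (ht : t ∈ D.TS y) : D.J y t = 0 := by
  rw [J_apply_eq_zero_iff]; exact D.Q_apply_eq_zero_of_mem_TS ht

/-- `J` kills the normal space of `N`. [folklore] -/
theorem J_apply_eq_zero_of_mem_TN_orthogonal {y : S} {u : V} (hu : u ∈ (D.TN y)ᗮ) :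
    D.J y u = 0 := by
  rw [J_apply_eq_zero_iff]; exact D.Q_apply_eq_zero_of_mem_TN_orthogonal hu

end Setup

end SurfaceTube

end Literature.Geometry.Symplectic
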